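import Summits.HodgeConjecture.HodgeConjecture.Theorems.F0P5TP2StubS2OrbitMap
import Summits.HodgeConjecture.HodgeConjecture.Theorems.HLiu418S1BettiSliceExclusion
import Literature.NumberTheory.Automorphic.UnitaryCurveCotangentSpectralProjection
import Literature.NumberTheory.Automorphic.UnitaryGroupSliceContinuity
import Literature.AlgebraicGeometry.ShimuraVarieties.UnitaryCurveConeSliceRegularity
import HarnessLib

/-!
# Crux `HLiu418` — K-LANE SUB-LINE F0-P5TP2SpectralProjection, STUB (S₂) — part 2 (the CM assembly at rank 2):
# the `L²` class of a cone-holomorphic cotangent form carries the `L²`-level cotangent data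

HC_CM is proved only modulo the printed citations until rung 0 closes.  Cell `hodgecm-mathlib`, floor 0, programme P5, named fact
TP₂ = ★ `UnitaryCurveForms.holCotFormSpectralProjection₂`, sub-line skeleton `Cruxes/HLiu418/Lines/F0_P5TP2SpectralProjection.lean`
(A-p14 (g16), v1 d60641ce), registered stub `theorem stub_S₂ : StubS₂CotFormL2Data`.  This file proves `stubS₂_holds`, whose
statement is the body of `StubS₂CotFormL2Data` BINDER FOR BINDER with the Lines-local bundles unfolded (nothing imports the Lines
module); the registrar's fold is printed in the docstring of `stubS₂_holds`.  THEOREMS ONLY; no definition, no instance, no `sorry`.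

* §1 (any cone frame `𝔣`, any `ℝ`-linear `X`, `γ z = exp (X z)` in `U(σ_{w₁}J)(ℂ)`): `expFamily_zero`, `expFamily_ray` (the ray law
  `γ((s+t)z) = γ(sz)γ(tz)`); `continuous_fderiv_probe_of_isConeHol` — for `IsConeHol 𝔣 Φ` the probe differential
  `u ↦ fderiv ℝ (w ↦ Φ(u exp(Xw))) 0 z` is continuous on `U(σ_{w₁}J)(ℂ)` (joint smoothness ★ `UnitaryCurveCone.contDiffOn_probe₂_of_isConeHol`).
* §2 `stubS₂_holds` — see its docstring.

## References
* [Borel1997] A. Borel, *Automorphic forms on SL₂(ℝ)*, Cambridge Tracts in Math. 130 (1997), §2.1 (4), §2.13, §5.13–§5.14.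
* [BorelJacquet1979] A. Borel, H. Jacquet, *Automorphic forms and automorphic representations*, PSPM 33.1 (1979), §4.1–4.2, §4.6.
* [BorelWallach2000] A. Borel, N. Wallach, *Continuous cohomology, discrete subgroups, and representations…*, 2nd ed., VII 2.10.
-/

set_option autoImplicit false
set_option linter.dupNamespace false -- the mandated namespace repeats `HodgeConjecture.HodgeConjecture`

noncomputable section

namespace Summit.HodgeConjecture.HodgeConjecture.Cruxes.HLiu418.F0P5TP2StubS2

open scoped Matrix ComplexOrder ContDiff
open NumberField NumberField.InfinitePlace MeasureTheory Topology Filter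
open Literature.NumberTheory.Automorphic Literature.NumberTheory.Automorphic.UnitaryGroup
open Literature.NumberTheory.Automorphic.UnitaryCurveForms
open Literature.NumberTheory.Automorphic.UnitaryGroup.CotangentForms (toQuotFun toQuotFun_mk)
open Literature.AlgebraicGeometry.ShimuraVarieties
open Summit.HodgeConjecture.HodgeConjecture.Cruxes.H413.SpectrumJunction
open Summit.HodgeConjecture.HodgeConjecture.Cruxes.HLiu418.F0P5TP2StubS2OrbitMap

/-! ## §1 The cone frame's probe family: ray law, continuity; continuity of the probe differential along `U`-slices -/

section Frame

open scoped Matrix.Norms.Operator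

variable {E : Type} [Field E] {J : Matrix (Fin 2) (Fin 2) E} {w₁ : {w : InfinitePlace E // IsComplex w}}
  (𝔣 : ConeFrame E J w₁) (X : ℂ →ₗ[ℝ] Matrix (Fin 2) (Fin 2) ℂ)
  (γ : ℂ → archLocal E 2 J w₁) (hγ : ∀ z, ((γ z : GL (Fin 2) ℂ) : Matrix (Fin 2) (Fin 2) ℂ) = NormedSpace.exp (X z))

include hγ in
/-- `γ 0 = 1` for the exponential family `γ z = exp (X z)`. [cite: Borel1997, §5.13–§5.14] -/
theorem expFamily_zero : γ 0 = 1 :=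
  Subtype.ext (Units.ext (by rw [hγ 0, map_zero, NormedSpace.exp_zero]; rfl))

include hγ in
/-- **Ray law** `γ((s+t)z) = γ(sz) γ(tz)` (`s t : ℝ`) for `γ z = exp (X z)`, `X` `ℝ`-linear: `exp((s+t)Xz) = exp(sXz) exp(tXz)`.
[cite: Borel1997, §2.1 (4)] -/
theorem expFamily_ray (s t : ℝ) (z : ℂ) :
    γ (((s + t : ℝ) : ℂ) * z) = γ (((s : ℝ) : ℂ) * z) * γ (((t : ℝ) : ℂ) * z) := by
  have hsm : ∀ r : ℝ, X (((r : ℝ) : ℂ) * z) = r • X z := fun r => by rw [← Complex.real_smul, map_smul]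
  refine Subtype.ext (Units.ext ?_)
  rw [Subgroup.coe_mul, Units.val_mul, hγ, hγ, hγ, hsm, hsm, hsm, add_smul]
  exact Matrix.exp_add_of_commute _ _ (((Commute.refl (X z)).smul_left s).smul_right t)

/-- **The probe differential of a cone-holomorphic function is continuous along `U`**: for `IsConeHol 𝔣 Φ` and every `z`,
`u ↦ fderiv ℝ (w ↦ Φ(u · exp(X w))) 0 z` is continuous on `U(σ_{w₁}J)(ℂ)` — the joint map `(g, w) ↦ Φ(g exp(Xw))` is `C^∞` on the open
set where `g exp(Xw)` lies in the cone-open (★ `UnitaryCurveCone.contDiffOn_probe₂_of_isConeHol`), the partial differential in `w` at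
`(g, 0)` is the total one composed with `inr`, and the total differential is continuous there. [cite: Borel1997, §2.13 and §5.14] -/
theorem continuous_fderiv_probe_of_isConeHol {Φ : Matrix (Fin 2) (Fin 2) ℂ → ℂ} (hΦ : IsConeHol 𝔣 Φ) (z : ℂ) :
    Continuous fun u : archLocal E 2 J w₁ =>
      fderiv ℝ (fun w : ℂ => Φ (((u : GL (Fin 2) ℂ) : Matrix (Fin 2) (Fin 2) ℂ) * NormedSpace.exp (X w))) 0 z := by
  -- the joint map and the open set where it is smooth
  obtain ⟨P, hP⟩ : ∃ P : (Fin 2 → Fin 2 → ℂ) × ℂ → ℂ, ∀ p, P p = Φ (Matrix.of p.1 * NormedSpace.exp (X p.2)) := ⟨_, fun _ => rfl⟩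
  set V : Set ((Fin 2 → Fin 2 → ℂ) × ℂ) := {p | IsUnit (Matrix.of p.1 * NormedSpace.exp (X p.2)) ∧
      (Matrix.of p.1 * NormedSpace.exp (X p.2)) *ᵥ 𝔣.v₀ ∈ negCone (J.map w₁.1.embedding)} with hV
  have hX : Continuous X := X.continuous_of_finiteDimensional
  have hπ : Continuous fun p : (Fin 2 → Fin 2 → ℂ) × ℂ => Matrix.of.symm (Matrix.of p.1 * NormedSpace.exp (X p.2)) :=
    (continuous_fst).mul (NormedSpace.exp_continuous.comp (hX.comp continuous_snd))
  have hVo : IsOpen V := by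
    have e : V = (fun p : (Fin 2 → Fin 2 → ℂ) × ℂ => Matrix.of.symm (Matrix.of p.1 * NormedSpace.exp (X p.2))) ⁻¹'
        {m : Fin 2 → Fin 2 → ℂ | IsUnit (Matrix.of m) ∧ Matrix.of m *ᵥ 𝔣.v₀ ∈ negCone (J.map w₁.1.embedding)} := by
      ext p; simp only [hV, Set.mem_setOf_eq, Set.mem_preimage]; rfl
    rw [e]
    exact (UnitaryCurveCone.isOpen_coneOpen 𝔣).preimage hπ
  have hPV : ContDiffOn ℝ ∞ P V := by
    have e : P = fun p : (Fin 2 → Fin 2 → ℂ) × ℂ => Φ (Matrix.of p.1 * NormedSpace.exp (X p.2)) := funext hP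
    rw [e]
    exact UnitaryCurveCone.contDiffOn_probe₂_of_isConeHol hΦ X
  have hPd : ContinuousOn (fderiv ℝ P) V := hPV.continuousOn_fderiv_of_isOpen hVo (by simp)
  -- the points `(u, 0)` lie in `V`
  have hmemV : ∀ u : archLocal E 2 J w₁, (Matrix.of.symm ((u : GL (Fin 2) ℂ) : Matrix (Fin 2) (Fin 2) ℂ), (0 : ℂ)) ∈ V := by
    intro u
    simp only [hV, Set.mem_setOf_eq, map_zero, NormedSpace.exp_zero, Matrix.mul_one]
    exact ⟨(UnitaryCurveCone.isUnit_and_mulVec_mem_negCone 𝔣 u).1, (UnitaryCurveCone.isUnit_and_mulVec_mem_negCone 𝔣 u).2⟩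
  -- the partial differential in `w` at `(u, 0)` is the total one on `(0, z)`
  have hpartial : ∀ u : archLocal E 2 J w₁,
      fderiv ℝ (fun w : ℂ => Φ (((u : GL (Fin 2) ℂ) : Matrix (Fin 2) (Fin 2) ℂ) * NormedSpace.exp (X w))) 0 z =
        fderiv ℝ P (Matrix.of.symm ((u : GL (Fin 2) ℂ) : Matrix (Fin 2) (Fin 2) ℂ), 0) ((0 : Fin 2 → Fin 2 → ℂ), z) := by
    intro u
    set g₀ : Fin 2 → Fin 2 → ℂ := Matrix.of.symm ((u : GL (Fin 2) ℂ) : Matrix (Fin 2) (Fin 2) ℂ) with hg₀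
    have hPat : HasFDerivAt P (fderiv ℝ P (g₀, 0)) (g₀, 0) :=
      ((hPV.differentiableOn (by simp)).differentiableAt (hVo.mem_nhds (hmemV u))).hasFDerivAt
    have hinr : HasFDerivAt (fun w : ℂ => (g₀, w)) (ContinuousLinearMap.inr ℝ (Fin 2 → Fin 2 → ℂ) ℂ) 0 :=
      hasFDerivAt_prodMk_right g₀ 0
    have hcomp := hPat.comp (0 : ℂ) hinr
    have e : (P ∘ fun w : ℂ => (g₀, w)) =
        fun w : ℂ => Φ (((u : GL (Fin 2) ℂ) : Matrix (Fin 2) (Fin 2) ℂ) * NormedSpace.exp (X w)) := by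
      funext w
      simp only [Function.comp_apply, hP, hg₀]
      rfl
    rw [e] at hcomp
    rw [hcomp.fderiv, ContinuousLinearMap.comp_apply, ContinuousLinearMap.inr_apply]
  have hcont : Continuous fun u : archLocal E 2 J w₁ =>
      fderiv ℝ P (Matrix.of.symm ((u : GL (Fin 2) ℂ) : Matrix (Fin 2) (Fin 2) ℂ), 0) := by
    have hemb : Continuous fun u : archLocal E 2 J w₁ =>
        (Matrix.of.symm ((u : GL (Fin 2) ℂ) : Matrix (Fin 2) (Fin 2) ℂ), (0 : ℂ)) :=
      (Units.continuous_val.comp continuous_subtype_val).prodMk continuous_const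
    exact hPd.comp_continuous hemb hmemV
  simp_rw [hpartial]
  exact hcont.clm_apply continuous_const

end Frame

/-! ## §2 STUB (S₂) — the CM assembly -/

section CM

open scoped Matrix.Norms.Operator

/-- **STUB (S₂) `stub_S₂ : StubS₂CotFormL2Data` of `Lines/F0_P5TP2SpectralProjection.lean` — its body BINDER FOR BINDER** with the
Lines-local bundles unfolded (`G2 L H` ↦ `adelicGroupData L⁺ L c̄ 2 H`, `sec₁` ↦ `adelicSingle (cmPlace L ι)`, `Kc₁` written out,
the hypothesis `IsRegularKernel₁ γ A` ↦ its four fields `cont`, `supp`, `diff`, `contDeriv` as four hypotheses — the last two are not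
used —, the conclusion `IsL2CotPair₁ … ν A [f]` ↦ the nested conjunction of its six fields `repro ∧ kc ∧ kf ∧ ktype ∧ diffOrbit ∧ weakHol`
with `kernelOp₁`, `orbitP₁`, `IsWeaklyHol₁` unfolded).  The registrar's fold is
`fun L _ _ _ ι H dV hdV hdV0 t ht g hdiag hJ hsig hdef h4 𝔣 X hXu hXv hXt γ hγ μ _ _ _ ν _ A hA hrep f hfm hf => let h := stubS₂_holds L ι H dV
hdV hdV0 t ht g hdiag hJ hsig hdef h4 𝔣 X hXu hXv hXt γ hγ μ ν A hA.cont hA.supp hA.diff hA.contDeriv hrep f hfm hf; ⟨h.1, h.2.1, h.2.2.1,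
h.2.2.2.1, h.2.2.2.2.1, h.2.2.2.2.2⟩`.  MATHEMATICS (`f ∈ holCotForms₂ 𝔣` with square-integrable descent, `U(H)` anisotropic because
`t • H ≃ diag dV` is definite at a place `≠ ι`, which exists as `[L:ℚ] ≥ 4` — so the quotient is COMPACT, ★ `compactSpace_cmDatum_automorphicQuotient`):
`f` and its probe differentials `y ↦ D_y z` are CONTINUOUS on `U(H)(𝔸)` (continuous `U(σ_ι H)`-slices by the cone dictionary ★
`continuous_slice_of_isConeHol` ∕ `continuous_fderiv_probe_of_isConeHol`, right `K_c`∕`K_f`-invariance, ★ `UnitaryGroupSliceContinuity`);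
`repro` is the `L²` image (★ `F0P5TP2StubS2OrbitMap.integral_smul_rightRegular_toLp_eq_self`) of the pointwise reproduction of the
`IsConeHol` slice `Φ_y` of `f` at `y` by the kernel `A`; `kc`, `kf`, `ktype` are the `L²` images of the pointwise right invariances and of
the cotangent law of `Φ_x` at `g = 1`; `diffOrbit`, `weakHol` are ★ `differentiableAt_rightRegular_toLp_of_probeCR` (first-order mean
value along the rays of `γ z = exp(Xz)` + uniform smallness on the compact quotient) fed with pointwise Cauchy–Riemann ★ `probeCR_of_isConeHol`.
[cite: Borel1997, §2.13 and §5.14] [cite: BorelJacquet1979, §4.2 and §4.6] [cite: BorelWallach2000, VII 2.10] -/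
theorem stubS₂_holds :
    ∀ (L : Type) [Field L] [NumberField L] [IsCMField L] (ι : L →+* ℂ) (H : Matrix (Fin 2) (Fin 2) L)
    (dV : Fin 2 → L) (_hdV : ∀ i, IsCMField.complexConj L (dV i) = dV i) (_hdV0 : ∀ i, dV i ≠ 0)
    (t : L) (_ht : t ≠ 0) (g : GL (Fin 2) L),
    formCongr ((IsCMField.complexConj L : L ≃ₐ[↥(maximalRealSubfield L)] L) : L →+* L) g (t • H) = Matrix.diagonal dV →
    (H.map (cmPlace L ι).1.embedding).IsHermitian →
    (∃ T : GL (Fin 2) ℂ, formCongr (starRingEnd ℂ) T ((Matrix.diagonal dV).map ι) = Matrix.diagonal ![(1 : ℂ), -1]) →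
    (∀ τ' : L →+* ℂ, InfinitePlace.mk τ' ≠ InfinitePlace.mk ι → ((Matrix.diagonal dV).map τ').PosDef) →
    4 ≤ Module.finrank ℚ L →
    ∀ (𝔣 : ConeFrame L H (cmPlace L ι)) (X : ℂ →ₗ[ℝ] Matrix (Fin 2) (Fin 2) ℂ),
      (∀ z, (X z)ᴴ * H.map (cmPlace L ι).1.embedding + H.map (cmPlace L ι).1.embedding * X z = 0) →
      (∀ z, X z *ᵥ 𝔣.v₀ = z • 𝔣.t₀) → (∀ z, ∃ c : ℂ, X z *ᵥ 𝔣.t₀ = c • 𝔣.v₀) →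
    ∀ (γ : ℂ → archLocal L 2 H (cmPlace L ι)),
      (∀ z, ((γ z : GL (Fin 2) ℂ) : Matrix (Fin 2) (Fin 2) ℂ) = NormedSpace.exp (X z)) →
    ∀ (μ : Measure (adelicGroupData (↥(maximalRealSubfield L)) L (IsCMField.complexConj L) 2 H).automorphicQuotient) [(adelicGroupData (↥(maximalRealSubfield L)) L (IsCMField.complexConj L) 2 H).IsAutomorphicMeasure μ]
      [MeasurableSpace (archLocal L 2 H (cmPlace L ι))] [BorelSpace (archLocal L 2 H (cmPlace L ι))]
      (ν : Measure (archLocal L 2 H (cmPlace L ι))) [ν.IsHaarMeasure] (A : archLocal L 2 H (cmPlace L ι) → ℂ),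
      -- `IsRegularKernel₁ γ A`, field by field
      Continuous A → HasCompactSupport A →
      (∀ u' : archLocal L 2 H (cmPlace L ι), ContDiff ℝ 1 fun z : ℂ => A (γ z * u')) →
      (Continuous fun p : ℂ × archLocal L 2 H (cmPlace L ι) => fderiv ℝ (fun z : ℂ => A (γ z * p.2)) p.1) →
      (∀ Φ : Matrix (Fin 2) (Fin 2) ℂ → ℂ, IsConeHol 𝔣 Φ → ∫ u, A u * Φ ((u : GL (Fin 2) ℂ) : Matrix (Fin 2) (Fin 2) ℂ) ∂ν = Φ 1) →
    ∀ (f : (adelicGroupData (↥(maximalRealSubfield L)) L (IsCMField.complexConj L) 2 H).Adelic → ℂ),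
      f ∈ holCotForms₂ (↥(maximalRealSubfield L)) L (IsCMField.complexConj L) H (IsCMField.complexConj_ne_one L)
          (UnitaryGroup.complexConj_smul_infinitePlace L) (cmPlace L ι) 𝔣 →
    ∀ hf : MemLp (toQuotFun (adelicGroupData (↥(maximalRealSubfield L)) L (IsCMField.complexConj L) 2 H) f) 2 μ,
      -- `IsL2CotPair₁ L ι H 𝔣 γ μ ν A [f]`, field by field
      (∫ u, A u • (adelicGroupData (↥(maximalRealSubfield L)) L (IsCMField.complexConj L) 2 H).rightRegular μ
          (adelicSingle (↥(maximalRealSubfield L)) L (IsCMField.complexConj L) 2 H (IsCMField.complexConj_ne_one L)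
            (UnitaryGroup.complexConj_smul_infinitePlace L) (cmPlace L ι) u)
          (MemLp.toLp (toQuotFun (adelicGroupData (↥(maximalRealSubfield L)) L (IsCMField.complexConj L) 2 H) f) hf) ∂ν) =
        (MemLp.toLp (toQuotFun (adelicGroupData (↥(maximalRealSubfield L)) L (IsCMField.complexConj L) 2 H) f) hf) ∧
      (∀ k ∈ ((archAt (↥(maximalRealSubfield L)) L (IsCMField.complexConj L) 2 H (cmPlace L ι)
          (UnitaryGroup.complexConj_smul_infinitePlace L (cmPlace L ι).1) (IsCMField.complexConj_ne_one L)).ker).map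
        (archToAdelic (↥(maximalRealSubfield L)) L (IsCMField.complexConj L) 2 H),
        (adelicGroupData (↥(maximalRealSubfield L)) L (IsCMField.complexConj L) 2 H).rightRegular μ k (MemLp.toLp (toQuotFun (adelicGroupData (↥(maximalRealSubfield L)) L (IsCMField.complexConj L) 2 H) f) hf) =
          (MemLp.toLp (toQuotFun (adelicGroupData (↥(maximalRealSubfield L)) L (IsCMField.complexConj L) 2 H) f) hf)) ∧
      (∃ Kf : Subgroup (finAdelic (↥(maximalRealSubfield L)) L (IsCMField.complexConj L) 2 H),
        IsOpen (Kf : Set (finAdelic (↥(maximalRealSubfield L)) L (IsCMField.complexConj L) 2 H)) ∧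
          ∀ k ∈ Kf, (adelicGroupData (↥(maximalRealSubfield L)) L (IsCMField.complexConj L) 2 H).rightRegular μ
              (finAdelicToAdelic (↥(maximalRealSubfield L)) L (IsCMField.complexConj L) 2 H k) (MemLp.toLp (toQuotFun (adelicGroupData (↥(maximalRealSubfield L)) L (IsCMField.complexConj L) 2 H) f) hf) =
            (MemLp.toLp (toQuotFun (adelicGroupData (↥(maximalRealSubfield L)) L (IsCMField.complexConj L) 2 H) f) hf)) ∧
      (∀ (κ : archLocal L 2 H (cmPlace L ι)) (a k d : ℂ), k ≠ 0 →
        ((κ : GL (Fin 2) ℂ) : Matrix (Fin 2) (Fin 2) ℂ) *ᵥ 𝔣.v₀ = k • 𝔣.v₀ →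
        ((κ : GL (Fin 2) ℂ) : Matrix (Fin 2) (Fin 2) ℂ) *ᵥ 𝔣.t₀ = a • 𝔣.t₀ + d • 𝔣.v₀ →
          (adelicGroupData (↥(maximalRealSubfield L)) L (IsCMField.complexConj L) 2 H).rightRegular μ
              (adelicSingle (↥(maximalRealSubfield L)) L (IsCMField.complexConj L) 2 H (IsCMField.complexConj_ne_one L)
            (UnitaryGroup.complexConj_smul_infinitePlace L) (cmPlace L ι) κ) (MemLp.toLp (toQuotFun (adelicGroupData (↥(maximalRealSubfield L)) L (IsCMField.complexConj L) 2 H) f) hf) =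
            (a * k⁻¹) • (MemLp.toLp (toQuotFun (adelicGroupData (↥(maximalRealSubfield L)) L (IsCMField.complexConj L) 2 H) f) hf)) ∧
      DifferentiableAt ℝ (fun z : ℂ => (adelicGroupData (↥(maximalRealSubfield L)) L (IsCMField.complexConj L) 2 H).rightRegular μ
          (adelicSingle (↥(maximalRealSubfield L)) L (IsCMField.complexConj L) 2 H (IsCMField.complexConj_ne_one L)
            (UnitaryGroup.complexConj_smul_infinitePlace L) (cmPlace L ι) (γ z)) (MemLp.toLp (toQuotFun (adelicGroupData (↥(maximalRealSubfield L)) L (IsCMField.complexConj L) 2 H) f) hf)) 0 ∧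
      ∀ z : ℂ, fderiv ℝ (fun z : ℂ => (adelicGroupData (↥(maximalRealSubfield L)) L (IsCMField.complexConj L) 2 H).rightRegular μ
            (adelicSingle (↥(maximalRealSubfield L)) L (IsCMField.complexConj L) 2 H (IsCMField.complexConj_ne_one L)
            (UnitaryGroup.complexConj_smul_infinitePlace L) (cmPlace L ι) (γ z)) (MemLp.toLp (toQuotFun (adelicGroupData (↥(maximalRealSubfield L)) L (IsCMField.complexConj L) 2 H) f) hf)) 0 (Complex.I • z) =
          Complex.I • fderiv ℝ (fun z : ℂ => (adelicGroupData (↥(maximalRealSubfield L)) L (IsCMField.complexConj L) 2 H).rightRegular μ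
            (adelicSingle (↥(maximalRealSubfield L)) L (IsCMField.complexConj L) 2 H (IsCMField.complexConj_ne_one L)
            (UnitaryGroup.complexConj_smul_infinitePlace L) (cmPlace L ι) (γ z)) (MemLp.toLp (toQuotFun (adelicGroupData (↥(maximalRealSubfield L)) L (IsCMField.complexConj L) 2 H) f) hf)) 0 z := by
  intro L _ _ _ ι H dV _ _ t _ g hdiag _ _ hdef h4 𝔣 X _ hXv hXt γ hγ μ _ _ _ ν _ A hAc hAs _ _ hrep f hfm hf
  -- instances on `U := U(σ_ι H)(ℂ)` (second countable, locally compact) and the COMPACT automorphic quotient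
  haveI : SecondCountableTopology (GL (Fin 2) ℂ) :=
    (Units.isOpenEmbedding_val (R := Matrix (Fin 2) (Fin 2) ℂ)).isEmbedding.secondCountableTopology
  haveI : LocallyCompactSpace (Matrix (Fin 2) (Fin 2) ℂ) := inferInstanceAs (LocallyCompactSpace (Fin 2 → Fin 2 → ℂ))
  haveI : LocallyCompactSpace (GL (Fin 2) ℂ) := (Units.isOpenEmbedding_val (R := Matrix (Fin 2) (Fin 2) ℂ)).locallyCompactSpace
  haveI : LocallyCompactSpace (archLocal L 2 H (cmPlace L ι)) :=
    (isClosed_archLocal L 2 H (cmPlace L ι)).isClosedEmbedding_subtypeVal.locallyCompactSpace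
  obtain ⟨τ, hτ⟩ := UnitaryGroup.exists_infinitePlace_ne L h4 ι
  haveI : CompactSpace (adelicGroupData (↥(maximalRealSubfield L)) L (IsCMField.complexConj L) 2 H).automorphicQuotient :=
    UnitaryGroup.compactSpace_cmDatum_automorphicQuotient L 2 H
      (S1BettiSliceExclusion.anisotropic_of_formCongr_posDef L H t g dV hdiag τ (hdef τ hτ))
  -- the four clauses of `f ∈ holCotForms₂ 𝔣`; left invariance under `A_G · G(K) = U(H)(L⁺)`
  obtain ⟨hL, hKc, ⟨Kf, hKo, hKf⟩, hH⟩ := hfm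
  have hleft : ∀ γr ∈ (adelicGroupData (↥(maximalRealSubfield L)) L (IsCMField.complexConj L) 2 H).quotientSubgroup, ∀ x, f (γr * x) = f x := by
    intro γr hγr x
    rw [quotientSubgroup_adelicGroupData] at hγr
    obtain ⟨r, rfl⟩ := hγr
    exact hL r x
  choose Φs hΦs hΦsf using hH
  -- the probes of `f` are probes of the cone-holomorphic slices
  have hprobe : ∀ y : (adelicGroupData (↥(maximalRealSubfield L)) L (IsCMField.complexConj L) 2 H).Adelic, (fun w : ℂ => f (y * adelicSingle (↥(maximalRealSubfield L)) L (IsCMField.complexConj L) 2 H (IsCMField.complexConj_ne_one L)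
            (UnitaryGroup.complexConj_smul_infinitePlace L) (cmPlace L ι) (γ w))) =
      fun w : ℂ => Φs y ((((1 : archLocal L 2 H (cmPlace L ι)) : GL (Fin 2) ℂ) : Matrix (Fin 2) (Fin 2) ℂ) *
        NormedSpace.exp (X w)) := by
    intro y
    funext w
    rw [← hΦsf y (γ w), hγ w, OneMemClass.coe_one, Units.val_one, Matrix.one_mul]
  have hprobe₂ : ∀ (x : (adelicGroupData (↥(maximalRealSubfield L)) L (IsCMField.complexConj L) 2 H).Adelic) (u : archLocal L 2 H (cmPlace L ι)),
      (fun w : ℂ => f (x * adelicSingle (↥(maximalRealSubfield L)) L (IsCMField.complexConj L) 2 H (IsCMField.complexConj_ne_one L)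
            (UnitaryGroup.complexConj_smul_infinitePlace L) (cmPlace L ι) u * adelicSingle (↥(maximalRealSubfield L)) L (IsCMField.complexConj L) 2 H (IsCMField.complexConj_ne_one L)
            (UnitaryGroup.complexConj_smul_infinitePlace L) (cmPlace L ι) (γ w))) =
        fun w : ℂ => Φs x (((u : GL (Fin 2) ℂ) : Matrix (Fin 2) (Fin 2) ℂ) * NormedSpace.exp (X w)) := by
    intro x u
    funext w
    rw [mul_assoc, ← map_mul, ← hΦsf x (u * γ w), Subgroup.coe_mul, Units.val_mul, hγ w]
  -- commutations of the `w₁`-factor with `K_c` and `U(H)(𝔸_f)`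
  have hcommK : ∀ k ∈ ((archAt (↥(maximalRealSubfield L)) L (IsCMField.complexConj L) 2 H (cmPlace L ι)
          (UnitaryGroup.complexConj_smul_infinitePlace L (cmPlace L ι).1) (IsCMField.complexConj_ne_one L)).ker).map
        (archToAdelic (↥(maximalRealSubfield L)) L (IsCMField.complexConj L) 2 H), ∀ (x : (adelicGroupData (↥(maximalRealSubfield L)) L (IsCMField.complexConj L) 2 H).Adelic) (u : archLocal L 2 H (cmPlace L ι)),
      f (x * k * adelicSingle (↥(maximalRealSubfield L)) L (IsCMField.complexConj L) 2 H (IsCMField.complexConj_ne_one L)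
            (UnitaryGroup.complexConj_smul_infinitePlace L) (cmPlace L ι) u) = f (x * adelicSingle (↥(maximalRealSubfield L)) L (IsCMField.complexConj L) 2 H (IsCMField.complexConj_ne_one L)
            (UnitaryGroup.complexConj_smul_infinitePlace L) (cmPlace L ι) u) := by
    intro k hk x u
    rw [mul_assoc, ← adelicSingle_mul_eq_mul_of_mem_map_ker_archAt (↥(maximalRealSubfield L)) L (IsCMField.complexConj L) 2 H
      (IsCMField.complexConj_ne_one L) (UnitaryGroup.complexConj_smul_infinitePlace L) (cmPlace L ι) u k hk, ← mul_assoc, hKc k hk]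
  have hcommF : ∀ k ∈ Kf, ∀ (x : (adelicGroupData (↥(maximalRealSubfield L)) L (IsCMField.complexConj L) 2 H).Adelic) (u : archLocal L 2 H (cmPlace L ι)),
      f (x * finAdelicToAdelic (↥(maximalRealSubfield L)) L (IsCMField.complexConj L) 2 H k * adelicSingle (↥(maximalRealSubfield L)) L (IsCMField.complexConj L) 2 H (IsCMField.complexConj_ne_one L)
            (UnitaryGroup.complexConj_smul_infinitePlace L) (cmPlace L ι) u) = f (x * adelicSingle (↥(maximalRealSubfield L)) L (IsCMField.complexConj L) 2 H (IsCMField.complexConj_ne_one L)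
            (UnitaryGroup.complexConj_smul_infinitePlace L) (cmPlace L ι) u) := by
    intro k hk x u
    rw [mul_assoc, ← adelicSingle_mul_finAdelicToAdelic, ← mul_assoc, hKf k hk]
  -- `f` is continuous
  have hcont : Continuous f := by
    refine continuous_of_continuous_adelicSingle_slice_cm 2 L H (cmPlace L ι) f (fun x => ?_) hKc ⟨Kf, hKo, hKf⟩
    have e : (fun u : archLocal L 2 H (cmPlace L ι) => f (x * adelicSingle (↥(maximalRealSubfield L)) L (IsCMField.complexConj L) 2 H (IsCMField.complexConj_ne_one L)
            (UnitaryGroup.complexConj_smul_infinitePlace L) (cmPlace L ι) u)) =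
        fun u : archLocal L 2 H (cmPlace L ι) => Φs x ((u : GL (Fin 2) ℂ) : Matrix (Fin 2) (Fin 2) ℂ) :=
      funext fun u => (hΦsf x u).symm
    rw [e]
    exact UnitaryCurveCone.continuous_slice_of_isConeHol (hΦs x)
  -- the probes: differentiable at `0`, pointwise Cauchy–Riemann, continuous differential
  have hPCR : ∀ y : (adelicGroupData (↥(maximalRealSubfield L)) L (IsCMField.complexConj L) 2 H).Adelic, DifferentiableAt ℝ (fun w : ℂ => f (y * adelicSingle (↥(maximalRealSubfield L)) L (IsCMField.complexConj L) 2 H (IsCMField.complexConj_ne_one L)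
            (UnitaryGroup.complexConj_smul_infinitePlace L) (cmPlace L ι) (γ w))) 0 ∧
      ∀ z : ℂ, fderiv ℝ (fun w : ℂ => f (y * adelicSingle (↥(maximalRealSubfield L)) L (IsCMField.complexConj L) 2 H (IsCMField.complexConj_ne_one L)
            (UnitaryGroup.complexConj_smul_infinitePlace L) (cmPlace L ι) (γ w))) 0 (Complex.I • z) =
        Complex.I • fderiv ℝ (fun w : ℂ => f (y * adelicSingle (↥(maximalRealSubfield L)) L (IsCMField.complexConj L) 2 H (IsCMField.complexConj_ne_one L)
            (UnitaryGroup.complexConj_smul_infinitePlace L) (cmPlace L ι) (γ w))) 0 z := fun y => by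
    rw [hprobe y]
    exact UnitaryCurveCone.probeCR_of_isConeHol 𝔣 X hXv hXt (hΦs y) 1
  have hcontD : ∀ z : ℂ, Continuous fun y : (adelicGroupData (↥(maximalRealSubfield L)) L (IsCMField.complexConj L) 2 H).Adelic => fderiv ℝ (fun w : ℂ => f (y * adelicSingle (↥(maximalRealSubfield L)) L (IsCMField.complexConj L) 2 H (IsCMField.complexConj_ne_one L)
            (UnitaryGroup.complexConj_smul_infinitePlace L) (cmPlace L ι) (γ w))) 0 z := by
    intro z
    refine continuous_of_continuous_adelicSingle_slice_cm 2 L H (cmPlace L ι) _ (fun x => ?_) (fun k hk x => ?_)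
      ⟨Kf, hKo, fun k hk x => ?_⟩
    · have e : (fun u : archLocal L 2 H (cmPlace L ι) => fderiv ℝ (fun w : ℂ => f (x * adelicSingle (↥(maximalRealSubfield L)) L (IsCMField.complexConj L) 2 H (IsCMField.complexConj_ne_one L)
            (UnitaryGroup.complexConj_smul_infinitePlace L) (cmPlace L ι) u * adelicSingle (↥(maximalRealSubfield L)) L (IsCMField.complexConj L) 2 H (IsCMField.complexConj_ne_one L)
            (UnitaryGroup.complexConj_smul_infinitePlace L) (cmPlace L ι) (γ w))) 0 z) =
          fun u : archLocal L 2 H (cmPlace L ι) =>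
            fderiv ℝ (fun w : ℂ => Φs x (((u : GL (Fin 2) ℂ) : Matrix (Fin 2) (Fin 2) ℂ) * NormedSpace.exp (X w))) 0 z :=
        funext fun u => by rw [hprobe₂ x u]
      rw [e]
      exact continuous_fderiv_probe_of_isConeHol 𝔣 X (hΦs x) z
    · show fderiv ℝ (fun w : ℂ => f (x * k * adelicSingle (↥(maximalRealSubfield L)) L (IsCMField.complexConj L) 2 H (IsCMField.complexConj_ne_one L)
            (UnitaryGroup.complexConj_smul_infinitePlace L) (cmPlace L ι) (γ w))) 0 z = fderiv ℝ (fun w : ℂ => f (x * adelicSingle (↥(maximalRealSubfield L)) L (IsCMField.complexConj L) 2 H (IsCMField.complexConj_ne_one L)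
            (UnitaryGroup.complexConj_smul_infinitePlace L) (cmPlace L ι) (γ w))) 0 z
      simp only [hcommK k hk]
    · show fderiv ℝ (fun w : ℂ => f (x * finAdelicToAdelic (↥(maximalRealSubfield L)) L (IsCMField.complexConj L) 2 H k *
          adelicSingle (↥(maximalRealSubfield L)) L (IsCMField.complexConj L) 2 H (IsCMField.complexConj_ne_one L)
            (UnitaryGroup.complexConj_smul_infinitePlace L) (cmPlace L ι) (γ w))) 0 z = fderiv ℝ (fun w : ℂ => f (x * adelicSingle (↥(maximalRealSubfield L)) L (IsCMField.complexConj L) 2 H (IsCMField.complexConj_ne_one L)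
            (UnitaryGroup.complexConj_smul_infinitePlace L) (cmPlace L ι) (γ w))) 0 z
      simp only [hcommF k hk]
  -- the probe family: identity, ray law, continuity; the section is continuous
  have hγ0 := expFamily_zero X γ hγ
  have hγadd := expFamily_ray X γ hγ
  have hγc : Continuous γ := by
    -- `exp` and `X` are continuous; the inverse is `exp(−Xz)`
    have hX : Continuous X := X.continuous_of_finiteDimensional
    refine (Topology.IsInducing.subtypeVal).continuous_iff.2 (Units.continuous_iff.2 ⟨?_, ?_⟩)
    · have e : (fun z => ((γ z : GL (Fin 2) ℂ) : Matrix (Fin 2) (Fin 2) ℂ)) = fun z => NormedSpace.exp (X z) := funext hγ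
      simp only [Function.comp_def]
      rw [e]
      exact NormedSpace.exp_continuous.comp hX
    · have e : (fun z => (((γ z : GL (Fin 2) ℂ)⁻¹ : GL (Fin 2) ℂ) : Matrix (Fin 2) (Fin 2) ℂ)) = fun z => NormedSpace.exp (-X z) := by
        funext z
        exact Units.inv_eq_of_mul_eq_one_right (by rw [hγ z]; exact (UnitaryCurveCone.exp_mul_exp_neg (X z)).1)
      simp only [Function.comp_def]
      rw [e]
      exact NormedSpace.exp_continuous.comp hX.neg
  have hιc : Continuous (adelicSingle (↥(maximalRealSubfield L)) L (IsCMField.complexConj L) 2 H (IsCMField.complexConj_ne_one L)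
            (UnitaryGroup.complexConj_smul_infinitePlace L) (cmPlace L ι)) :=
    continuous_adelicSingle (↥(maximalRealSubfield L)) L (IsCMField.complexConj L) 2 H (IsCMField.complexConj_ne_one L)
      (UnitaryGroup.complexConj_smul_infinitePlace L) (cmPlace L ι)
  have h1 : ∀ x : (adelicGroupData (↥(maximalRealSubfield L)) L (IsCMField.complexConj L) 2 H).Adelic, Φs x 1 = f x := fun x => by
    have h := hΦsf x 1
    rw [map_one, mul_one, OneMemClass.coe_one, Units.val_one] at h
    exact h
  refine ⟨?_, fun k hk => rightRegular_toLp_toQuotFun_eq_self' hleft hf (hKc k hk),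
    ⟨Kf, hKo, fun k hk => rightRegular_toLp_toQuotFun_eq_self' hleft hf (hKf k hk)⟩, fun κ a k d hk hv ht => ?_,
    differentiableAt_rightRegular_toLp_of_probeCR hιc hγc hγ0 hγadd hleft hcont (fun y => (hPCR y).1) hcontD
      (fun y => (hPCR y).2) hf⟩
  · -- `repro`: pointwise reproduction of the slice `Φ_y` at `1`
    refine integral_smul_rightRegular_toLp_eq_self ν hιc hAc hAs hleft hf fun y => ?_
    have e : (fun u : archLocal L 2 H (cmPlace L ι) => A u * f (y * adelicSingle (↥(maximalRealSubfield L)) L (IsCMField.complexConj L) 2 H (IsCMField.complexConj_ne_one L)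
            (UnitaryGroup.complexConj_smul_infinitePlace L) (cmPlace L ι) u)) =
        fun u => A u * Φs y ((u : GL (Fin 2) ℂ) : Matrix (Fin 2) (Fin 2) ℂ) := funext fun u => by rw [hΦsf y u]
    rw [e, hrep (Φs y) (hΦs y), h1]
  · -- `ktype`: the cotangent law of the slice `Φ_x` at `g = 1`
    refine rightRegular_toLp_toQuotFun_eq_smul hleft hf (a * k⁻¹) fun x => ?_
    have hlaw := (hΦs x).2 1 ((κ : GL (Fin 2) ℂ) : Matrix (Fin 2) (Fin 2) ℂ) a k d isUnit_one
      (by rw [Matrix.one_mulVec]; exact 𝔣.v₀_mem) hk hv ht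
    rw [Matrix.one_mul] at hlaw
    rw [← hΦsf x κ, hlaw, h1]

end CM

end Summit.HodgeConjecture.HodgeConjecture.Cruxes.HLiu418.F0P5TP2StubS2

end
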